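import Literature.NumberTheory.EllipticCurves.SkinnerZhang2014.MultiplicativeIndivisibility
import Literature.NumberTheory.EllipticCurves.BSDRankZeroDensityProofs
import Literature.NumberTheory.EllipticCurves.BSDSelmerCMPConverseRankOneProofs
import Literature.NumberTheory.EllipticCurves.QuadraticTwistSelmerPInfty
import Literature.NumberTheory.EllipticCurves.OpenImageMazurAssemblyProofs
import Literature.NumberTheory.EllipticCurves.LeadingTermBSZOrdinaryProofs
import Literature.NumberTheory.EllipticCurves.BSDSelmerSkinnerThmBProofs
import Literature.NumberTheory.EllipticCurves.HeightDensityFullBSDOffS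
import Literature.NumberTheory.EllipticCurves.PAdicHeightsTateValuationProofs
import Literature.NumberTheory.EllipticCurves.BSDInvariantsProofs
import HarnessLib

/-!
# Bhargava–Skinner–Zhang, Theorem 9 (`#Sel^(p)(E/ℚ) = p ⟹ rank E(ℚ) = 1 ∧ ord_{s=1} L(E,s) = 1`),
# MULTIPLICATIVE-at-`p` LEG, in the kernel below Skinner–Zhang's Thm. 1.1 (an explicitly labelled
# OPEN hypothesis) and Cassels–Tate — and the binder `h9` of `bsz_rankLeOne_cRank_of_pieces` on
# the multiplicative part of `T`

Sixth sibling *proofs* file (theorems only: no definition, no named fact, no instance; D-0014 /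
D-0026) of `Literature.NumberTheory.EllipticCurves.LeadingTerm` for the rank part of BSD by naive
height; companion of `LeadingTermBSZRankOneLegProofs` (Thm. 9, GOOD-ORDINARY leg, below W. Zhang
2014 Thm. 1.4 (i)), written on the same pattern. Source:

> M. Bhargava, C. Skinner, W. Zhang, *A majority of elliptic curves over `ℚ` satisfy the Birch and
> Swinnerton-Dyer conjecture*, arXiv:1407.1826v2 (2014), **Theorem 9** (§2.2, p. 5; held text
> `paper:arxiv-1407.1826` p0005 L54–L74): "Let `p ≥ 5` be a prime. Let `E` be an elliptic curve
> over `ℚ` with conductor `N` such that: (a) `E` has good ordinary or multiplicative reduction at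
> `p`; (b) `E[p]` is an irreducible `Gal(ℚ̄/ℚ)`-module; (c) for all primes `ℓ ∣∣ N` such that
> `ℓ ≡ ±1 (mod p)`, `E[p]` is ramified at `ℓ`; (d) if `N` is not squarefree, then there exist at
> least two prime factors `ℓ ∣∣ N` with `ℓ ≠ p` and where `E[p]` is ramified; (e) if `E` has
> multiplicative reduction at `p` then `E[p]` is not finite at `p`, and if `E` has split
> multiplicative reduction at `p` then the `p`-adic Mazur–Tate–Teitelbaum `𝓛`-invariant `𝓛(E)`
> of `E` satisfies `ord_p(𝓛(E)) = 1`; (f) the `p`-Selmer group `S_p(E)` of `E` has order `p`.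
> Then the rank and analytic rank of `E` are both equal to `1`." Proof (ibid. L76–L80): "By a
> theorem of Cassels, the `p^∞`-Selmer group of `E` is isomorphic as a `ℤ_p`-module to
> `(ℚ_p/ℤ_p)^r ⊕ F ⊕ F` … Since `E(ℚ)[p]` is trivial under (b), the `p`-Selmer group `S_p(E)` is
> the `p`-torsion of the `p^∞`-Selmer group. Hence if `S_p(E)` has order `p`, then `F = 0` and
> `r = 1`. It follows from this observation and [Z] (for the case of good reduction) and [SZ]
> (for the case of multiplicative reduction) that … `ord_{s=1} L(E,s) = 1` and the rank of `E(ℚ)`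
> is `1`."

and §3.1 (p. 8, p0008 L20–L28), the sets `S₁'(p) ⊆ S₀(p)` ("if `E_{A,B}` has multiplicative
reduction at `p`, then `p ∤ ord_p(Δ(A,B))`; if `E_{A,B}` has split multiplicative reduction at
`p`, then `ord_p(𝓛(E_{A,B})) = 1`") and `S₁(p) ⊆ S₁'(p)` ("`p ∤ ord_ℓ(Δ(A,B))` for all primes
`ℓ ≡ ±1 (mod p)` such that `ord_ℓ(Δ(A,B)) > 0`"), with the proof of Lemma 18 (p. 9, p0009
L3–L11): "`𝓛(E_{A,B}) = log_p q / ord_p(q)` … `k = ord_p(q)` and if `p ∤ k`, then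
`𝓛(E_{A,B}) ∈ pℤ_p^×` if and only if `log_p q ∈ pℤ_p^×`."

Here "[SZ]" = C. Skinner, W. Zhang, *Indivisibility of Heegner points in the multiplicative case*,
arXiv:1407.1099v1 (2014), Thm. 1.1 — an UNREFEREED PREPRINT (no journal version as of August
2026), hence NOT a theorem of the tree's floor (cell ABSOLUTE RULE) but the labelled OPEN
hypothesis `SkinnerZhang2014.thm1_1_rank_one_of_selmerCorank_eq_one_OPEN`
(`SkinnerZhang2014/MultiplicativePConverse.lean`, registry A326, tier PRE; hypotheses (a)–(e) =
the predicate `SkinnerZhang2014.Hypotheses` of `SkinnerZhang2014/MultiplicativeIndivisibility.lean`).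
**Every theorem below that uses it takes it as the explicit hypothesis `hSZ` and is CONDITIONAL on
an unrefereed claim («literal-PRE»).** The TYPE of `hSZ` is the BODY of that `def`, verbatim, so
`(hOPEN : SkinnerZhang2014.thm1_1_rank_one_of_selmerCorank_eq_one_OPEN)` instantiates it by `hOPEN`
itself (δ-unfolding; the name is not imported only because that module's object file is not yet
built on the farm at the time of writing).

The theorem of record `bsz_rankLeOne_cRank_of_pieces` (`LeadingTermBSZResCellAssemblyProofs`)
consumes Theorem 9 at `p = 5` as the ANONYMOUS binder
`h9 : ∀ AB, IsInHeightFamily AB → T AB → S₁ AB → W AB → Nat.card ((shortWeierstrass AB).selmerGroup 5) = 5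
→ (shortWeierstrass AB).mordellWeilRank = 1 ∧ (shortWeierstrass AB).analyticRank = 1`. The sibling
file proves its GOOD-ORDINARY leg below W. Zhang 2014 Thm. 1.4 (i) (PUB); this file proves its
MULTIPLICATIVE leg ("[SZ] (for the case of multiplicative reduction)") below

* `hSZ` — Skinner–Zhang Thm. 1.1 as above (OPEN, labelled);
* `hCT : exists_casselsTate_pairing (K := ℚ)` — "a theorem of Cassels" (the alternating pairing on
  `Ш`; registry A24), used exactly as printed: `#Sel^(p) = p ∧ E(ℚ)[p] = 0 ⟹
  corank_{ℤ_p} Sel_{p^∞}(E/ℚ) = 1` (tree `exists_selmerRank_eq_add`: `s_p = t_p + corank + 2m`);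

and PROVED tree theorems only (no further named fact): `ord_p q_E = ord_p Δ_min`
(`TateParameterData.valuation_q_eq_padicValInt_holds`), `ord_ℓ Δ_min = ord_ℓ(4A³ + 27B²)` for
`ℓ ≥ 5` on the height family (`padicValInt_minimalDiscriminantInt_smul_shortWeierstrass`), the
reduction type of `E_{A,B}` at `ℓ ≥ 5` (`hasMultiplicativeReductionAtPrime_shortWeierstrass_iff_of_isInHeightFamily`),
and the isomorphism invariance of every invariant in sight.

Contents:
* (PRIVATE) `szCassels_selmerCorank_eq_one` — the Cassels step `#Sel^(p) = p`, `E[p]` irreducible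
  ⟹ corank `1`, below `hCT` (public forms: `selmerCorank_eq_one_of_natCard_selmerGroup_eq` of
  `SelmerCardinalityPConverses.lean`, p369066, whose object file is not yet built; the sibling's
  private twin);
* `valuation_lInvariant_eq_valuation_padicLog_of_not_dvd` — **BSZ Lemma 18, the sentence "if
  `p ∤ k` then `𝓛(E) ∈ pℤ_p^×` iff `log_p q ∈ pℤ_p^×`"** as the equality
  `ord_p 𝓛_p(E) = ord_p log_p q_E` when `p ∤ ord_p(Δ_min)` (global minimal model);
* `skinnerZhang_hypotheses_of_exists_ramified_ne` — SZ's (a)–(e) from (a), (b), (c), (d) and ONE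
  multiplicative prime `ℓ ≠ p` with `p ∤ ord_ℓ(Δ)` (the two primes of (e) are `p` itself — by (a)
  and (b) — and `ℓ`);
* `bsz_thm9_multiplicative_of_skinnerZhang` — **Theorem 9, multiplicative leg**, in Skinner–Zhang's
  currency (global minimal `W`, `p ≥ 5`, `Hypotheses W p`, `#Sel^(p) = p`);
* `bsz_thm9_multiplicative_of_skinnerZhang_of_smul_eq` — the same for ANY model `C • W = E`
  ((f) read on `E`; (a)–(e) on `W`, as they mention `Δ_min`, `q_E`);
* `bsz_h9_multiplicative_five_of_skinnerZhang` — **the binder `h9` in the `(A, B)` currency on the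
  multiplicative part of `T ⊆ S₀(5)`**, hypotheses = the printed bullets of `S₀(5)`, `S₁'(5)`,
  `S₁(5)` in `(A, B)` currency + (irr) + one ramified multiplicative `ℓ > 5` (Remark 7:
  `5 ∤ ord_ℓ(4A³ + 27B²)`; Lemma 20's proof supplies such `ℓ ≥ 5`, `ℓ ≠ p`) + `#Sel^(5) = 5`;
  Skinner–Zhang's (a)–(e) are DERIVED inside on a global minimal model;
  `bsz_h9_multiplicative_five_of_skinnerZhang_of_ram` — the same with the (ram) prime read on the
  minimal model (`∃ ℓ ≠ 5`, `W` multiplicative at `ℓ`, `5 ∤ ord_ℓ(Δ_min)`: Thm 5 (c)'s binder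
  shape, `ℓ ∈ {2, 3}` allowed).

What is NOT done here: the sets `T`, `S₁`, `W` themselves (item C0, `BSZPieces.lean`); any claim
that [SZ] is a theorem. BSD-DENSITY SPRINT (cell `b2b-bsdres`, book `cells/density/CONVERSION-QUEUE.md`
§2 Q2, fork (q3) "carry «literal-PRE», labelled"): by-name consumer = the D2 glue
`bsz_rankLeOne_cRank_of_facts` (seat `b2b-bsdres-dens-p1`; interim service of
`b2b-bsdres-eisenstein-p2`). HONEST FRAMING: kernel glue below NAMED inputs, one of them an OPEN
preprint claim; nothing is booked; no density number, mark, tier or status word moves by this file.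

## References

* [BhargavaSkinnerZhang2014] M. Bhargava, C. Skinner, W. Zhang, arXiv:1407.1826v2, Thm. 9 and its
  proof (§2.2, p. 5); §3.1 (p. 8); Lemma 18 and its proof (pp. 8–9); Remarks 7, 11 (p. 5).
* [SkinnerZhang2014] C. Skinner, W. Zhang, arXiv:1407.1099v1 (2014), Thm. 1.1 (p. 1) — PREPRINT.
* [MazurTateTeitelbaum1986Invent] B. Mazur, J. Tate, J. Teitelbaum, Invent. Math. 84 (1986), §II.1.
* [SilvermanAEC2009] J. H. Silverman, *The Arithmetic of Elliptic Curves*, 2nd ed., GTM 106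
  (2009), Thm. X.4.2, Thm. X.4.14, VII.5 Prop. 5.1, VIII.8.
-/

noncomputable section

open scoped Classical
open scoped AddSubgroup

open WeierstrassCurve

namespace Literature.NumberTheory.EllipticCurves

/-! ### The Cassels step: `#Sel^(p) = p`, `E[p]` irreducible ⟹ corank `1` -/

section Cassels

/-- Equal Weierstrass equations have equal `j`-invariants, whatever the two proofs of ellipticity
(`IsElliptic` is a proposition). [folklore] -/
private theorem j_eq_of_eq {E₁ E₂ : WeierstrassCurve ℚ} [E₁.IsElliptic] [E₂.IsElliptic]
    (h : E₁ = E₂) : E₁.j = E₂.j := by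
  subst h
  rfl

/-- **"Since `E(ℚ)[p]` is trivial under (b) … if `S_p(E)` has order `p`, then `F = 0` and `r = 1`"**
(BSZ, proof of Thm 9): for an elliptic `W/ℚ` and a prime `p` with `E[p]` IRREDUCIBLE (so
`E(ℚ)[p] = 0`, tree `natCard_torsionBy_eq_one_of_hasIrreducibleModPGaloisRep`), `#Sel^(p)(E/ℚ) = p`
⟹ `corank_{ℤ_p} Sel_{p^∞}(E/ℚ) = 1`, below the Cassels–Tate pairing only (`hCT`): the tree's
`exists_selmerRank_eq_add` gives `s_p = t_p + corank + 2m`, here `s_p = 1`, `t_p = 0`. Private twin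
of `selmerCorank_eq_one_of_natCard_selmerGroup_eq` (`SelmerCardinalityPConverses.lean`).
[cite: BhargavaSkinnerZhang2014, Thm. 9 (proof, §2.2, p. 5)] [cite: SilvermanAEC2009, Thm. X.4.14] -/
private theorem szCassels_selmerCorank_eq_one
    (hCT : exists_casselsTate_pairing (K := ℚ))
    (W : WeierstrassCurve ℚ) [W.IsElliptic] (p : ℕ) [Fact p.Prime]
    (hirr : W.HasIrreducibleModPGaloisRep p) (hs : Nat.card (W.selmerGroup p) = p) :
    W.selmerCorank p = 1 := by
  have ht : Nat.card (W.toAffine.Point[(p : ℤ)]) = p ^ 0 := by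
    rw [pow_zero]
    exact natCard_torsionBy_eq_one_of_hasIrreducibleModPGaloisRep W p hirr
  obtain ⟨m, hm⟩ := exists_selmerRank_eq_add hCT W p 1 0 (by rw [pow_one]; exact hs)
    (by convert ht)
  omega

end Cassels

/-! ### BSZ Lemma 18: `ord_p 𝓛(E) = ord_p log_p q_E` when `p ∤ ord_p(Δ_min)` -/

section LInvariant

/-- **Bhargava–Skinner–Zhang, proof of Lemma 18** (arXiv:1407.1826 p. 9): "`𝓛(E_{A,B}) =
log_p q / ord_p(q)` … we see that `k = ord_p(q)`" (`k = ord_p Δ`) "and that if `p ∤ k`, then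
`𝓛(E_{A,B}) ∈ pℤ_p^×` if and only if `log_p q ∈ pℤ_p^×`." In the tree's currency: for a globally
minimal `W/ℚ`, a prime `p` and a Tate parameter datum `D` of `W` at `p` (so `W` is split
multiplicative at `p`), if `p ∤ ord_p(Δ_min)` then `ord_p 𝓛_p(E) = ord_p log_p q_E`
(`WeierstrassCurve.LInvariant D = log_p q / ord_p q`; `ord_p q = ord_p Δ_min` is the tree theorem
`TateParameterData.valuation_q_eq_padicValInt_holds`; a `p`-adic unit denominator does not change
the valuation — Mathlib `Padic.valuation_mul`, `Padic.valuation_inv`, `Padic.valuation_natCast`).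
In particular hypothesis (e) of BSZ Thm 9 ("`ord_p(𝓛(E)) = 1`") and hypothesis (b) of
Skinner–Zhang Thm 1.1 ("`log_p q_E ∈ pℤ_p^×`") agree under "`E[p]` not finite at `p`".
[cite: BhargavaSkinnerZhang2014, Lemma 18 (proof, p. 9)] [cite: MazurTateTeitelbaum1986Invent, §II.1] -/
theorem valuation_lInvariant_eq_valuation_padicLog_of_not_dvd
    (W : WeierstrassCurve ℚ) [W.IsElliptic] [W.IsGloballyMinimal] (p : ℕ) [Fact p.Prime]
    (D : TateParameterData W p) (hfin : ¬ p ∣ padicValInt p W.minimalDiscriminantInt) :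
    (LInvariant D).valuation = (padicLog p D.q).valuation := by
  have hk : D.q.valuation = padicValInt p W.minimalDiscriminantInt :=
    TateParameterData.valuation_q_eq_padicValInt_holds (W := W) (p := p) D
  -- the denominator `ord_p q = k` is a natural number prime to `p`, a `p`-adic unit
  set k : ℕ := padicValInt p W.minimalDiscriminantInt with hk_def
  have hkq : (D.q.valuation : ℚ_[p]) = (k : ℚ_[p]) := by
    rw [hk, Int.cast_natCast]
  have hk0 : k ≠ 0 := by
    intro h0
    have hpos := D.valuation_q_pos
    rw [hk, h0] at hpos
    norm_num at hpos
  have hkval : (k : ℚ_[p]).valuation = 0 := by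
    rw [Padic.valuation_natCast]
    exact_mod_cast padicValNat.eq_zero_of_not_dvd hfin
  have hkne : (k : ℚ_[p]) ≠ 0 := by exact_mod_cast hk0
  unfold LInvariant
  rw [hkq]
  by_cases hlog : padicLog p D.q = 0
  · rw [hlog, zero_div]
  · rw [div_eq_mul_inv, Padic.valuation_mul hlog (inv_ne_zero hkne), Padic.valuation_inv, hkval,
      neg_zero, add_zero]

end LInvariant

/-! ### Skinner–Zhang's hypotheses (a)–(e) from (a)–(d) and ONE ramified multiplicative `ℓ ≠ p` -/

section Hypotheses

/-- Skinner–Zhang's hypotheses (a)–(e) (`SkinnerZhang2014.Hypotheses W p`) hold as soon as (a) `W`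
is multiplicative at `p`, (b) `p ∤ ord_p(Δ_min)` and, if split, `log_p q_E ∈ pℤ_p^×`, (c) `E[p]`
is irreducible, (d) `p ∤ ord_ℓ(Δ_min)` at every multiplicative `ℓ ≡ ±1 (mod p)`, and there is ONE
multiplicative prime `ℓ ≠ p` with `p ∤ ord_ℓ(Δ_min)` — the (ram) hypothesis of BSZ Thm 5 (c) /
Remark 7, byte for byte `Skinner2016.thmC_padicValRat_bsd_rank_zero`'s `_hram`: hypothesis (e)
("at least two prime factors `ℓ ∣∣ N` such that `p ∤ ord_ℓ(Δ)`", `ℓ = p` allowed as printed) is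
witnessed by the pair `{p, ℓ}`, `p` qualifying by (a) and (b).
[cite: SkinnerZhang2014, Thm. 1.1, hypotheses (a)–(e) (arXiv:1407.1099v1 p. 1)]
[cite: BhargavaSkinnerZhang2014, Thm. 5 (c), Rem. 7 (§2.1, p. 5)] -/
theorem skinnerZhang_hypotheses_of_exists_ramified_ne
    (W : WeierstrassCurve ℚ) [W.IsElliptic] [W.IsGloballyMinimal] (p : ℕ) [Fact p.Prime]
    (hmult : W.HasMultiplicativeReductionAtPrime p)
    (hfin : ¬ p ∣ padicValInt p W.minimalDiscriminantInt)
    (hlog : W.HasSplitMultiplicativeReductionAtPrime p →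
      ∀ D : TateParameterData W p, (padicLog p D.q).valuation = 1)
    (hirr : W.HasIrreducibleModPGaloisRep p)
    (hcongr : ∀ (ℓ : ℕ) (_ : Fact ℓ.Prime), W.HasMultiplicativeReductionAtPrime ℓ →
      ((ℓ : ZMod p) = 1 ∨ (ℓ : ZMod p) = -1) → ¬ p ∣ padicValInt ℓ W.minimalDiscriminantInt)
    (hram : ∃ ℓ : ℕ, ∃ _ : Fact ℓ.Prime, ℓ ≠ p ∧ W.HasMultiplicativeReductionAtPrime ℓ ∧
      ¬ p ∣ padicValInt ℓ W.minimalDiscriminantInt) :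
    SkinnerZhang2014.Hypotheses W p := by
  obtain ⟨ℓ, iℓ, hne, hmℓ, hrℓ⟩ := hram
  exact
    { mult := hmult
      not_dvd_ord_disc := hfin
      log_tatePeriod := hlog
      irr := hirr
      ram_of_congr := hcongr
      two_ramified := ⟨p, ℓ, inferInstance, iℓ, hne.symm, hmult, hmℓ, hfin, hrℓ⟩ }

end Hypotheses

/-! ### Theorem 9, multiplicative leg, below Skinner–Zhang Thm 1.1 (OPEN, labelled) -/

section Multiplicative

/-- **Bhargava–Skinner–Zhang Thm 9, MULTIPLICATIVE LEG, in Skinner–Zhang's currency — CONDITIONAL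
on the unrefereed claim `hSZ`.** Let `E/ℚ` have globally minimal model `W` and let `p ≥ 5` be a
prime of multiplicative reduction such that Skinner–Zhang's (a)–(e) hold
(`SkinnerZhang2014.Hypotheses W p`: (a) `p ∣∣ N`; (b) `p ∤ ord_p(Δ)` and, if split,
`log_p q_E ∈ pℤ_p^×` — BSZ's (e), cf. `valuation_lInvariant_eq_valuation_padicLog_of_not_dvd`;
(c) `E[p]` irreducible — BSZ's (b); (d) `p ∤ ord_ℓ(Δ)` for `ℓ ∣∣ N`, `ℓ ≡ ±1 (mod p)` — BSZ's
(c) with Remark 7; (e) two primes `ℓ ∣∣ N` with `p ∤ ord_ℓ(Δ)` — BSZ's (d) / (c) of Thm 5) and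
`#Sel^(p)(E/ℚ) = p` (printed (f)). Then `rank E(ℚ) = 1 ∧ ord_{s=1} L(E,s) = 1` — granted
Skinner–Zhang arXiv:1407.1099 Thm. 1.1 (`hSZ`, whose type is VERBATIM the body of the OPEN
hypothesis `SkinnerZhang2014.thm1_1_rank_one_of_selmerCorank_eq_one_OPEN`, registry A326, PRE —
instantiate with that hypothesis itself) and the Cassels–Tate pairing (`hCT`): irreducible ⟹
`E(ℚ)[p] = 0`, so corank `1` (`szCassels_selmerCorank_eq_one`), and [SZ] gives both conclusions.
A result using this theorem is conditional on an unrefereed claim («literal-PRE»).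
[cite: BhargavaSkinnerZhang2014, Thm. 9 and its proof (§2.2, p. 5)]
[claim: SkinnerZhang2014, status: under-review] -/
theorem bsz_thm9_multiplicative_of_skinnerZhang
    (hSZ : ∀ (W : WeierstrassCurve ℚ) [W.IsElliptic] [W.IsGloballyMinimal] (p : ℕ) [Fact p.Prime],
      5 ≤ p → SkinnerZhang2014.Hypotheses W p → W.selmerCorank p = 1 →
      W.mordellWeilRank = 1 ∧ W.analyticRank = 1 ∧ Finite W.sha)
    (hCT : exists_casselsTate_pairing (K := ℚ))
    (W : WeierstrassCurve ℚ) [W.IsElliptic] [W.IsGloballyMinimal] (p : ℕ) [Fact p.Prime]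
    (hp : 5 ≤ p) (hH : SkinnerZhang2014.Hypotheses W p)
    (hSel : Nat.card (W.selmerGroup p) = p) :
    W.mordellWeilRank = 1 ∧ W.analyticRank = 1 := by
  have h1 : W.selmerCorank p = 1 := szCassels_selmerCorank_eq_one hCT W p hH.irr hSel
  exact ⟨(hSZ W p hp hH h1).1, (hSZ W p hp hH h1).2.1⟩

/-- **Thm 9, multiplicative leg, for an ARBITRARY model — CONDITIONAL on `hSZ`.** `E/ℚ` elliptic
with global minimal model `W`, `C • W = E`; `p ≥ 5`; Skinner–Zhang's (a)–(e) read on `W` (they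
mention `Δ_min` and the Tate period); (f) `#Sel^(p)(E/ℚ) = p` read on `E`. Irreducibility passes
to `E` (`Mazur1978.hasIrreducibleModPGaloisRep_smul_iff`), the corank is an isomorphism invariant
(`selmerCorank_eq_of_variableChange`), and the conclusion for `W` is transported back along
`mordellWeilRank_variableChange_holds` and `analyticRank_smul`.
[cite: BhargavaSkinnerZhang2014, Thm. 9 (§2.2, p. 5)] [cite: SilvermanAEC2009, X.§4 and VIII.8]
[claim: SkinnerZhang2014, status: under-review] -/
theorem bsz_thm9_multiplicative_of_skinnerZhang_of_smul_eq
    (hSZ : ∀ (W : WeierstrassCurve ℚ) [W.IsElliptic] [W.IsGloballyMinimal] (p : ℕ) [Fact p.Prime],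
      5 ≤ p → SkinnerZhang2014.Hypotheses W p → W.selmerCorank p = 1 →
      W.mordellWeilRank = 1 ∧ W.analyticRank = 1 ∧ Finite W.sha)
    (hCT : exists_casselsTate_pairing (K := ℚ))
    {W : WeierstrassCurve ℚ} [W.IsElliptic] [W.IsGloballyMinimal] {C : VariableChange ℚ}
    {E : WeierstrassCurve ℚ} [E.IsElliptic] (hCW : C • W = E) (p : ℕ) [Fact p.Prime]
    (hp : 5 ≤ p) (hH : SkinnerZhang2014.Hypotheses W p)
    (hSel : Nat.card (E.selmerGroup p) = p) :
    E.mordellWeilRank = 1 ∧ E.analyticRank = 1 := by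
  have hWE : C⁻¹ • E = W := by rw [← hCW, smul_smul, inv_mul_cancel, one_smul]
  -- (c) on `E`, the corank on `E`, then on the minimal model
  have hirrE : E.HasIrreducibleModPGaloisRep p := by
    rw [← hCW]; exact (Mazur1978.hasIrreducibleModPGaloisRep_smul_iff W C p).2 hH.irr
  have h1E : E.selmerCorank p = 1 := szCassels_selmerCorank_eq_one hCT E p hirrE hSel
  have h1W : W.selmerCorank p = 1 := by
    rw [← selmerCorank_eq_of_variableChange p hWE]; exact h1E
  obtain ⟨hrkW, hanW, -⟩ := hSZ W p hp hH h1W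
  refine ⟨?_, ?_⟩
  · have h : (C⁻¹ • E).mordellWeilRank = E.mordellWeilRank := mordellWeilRank_variableChange_holds E C⁻¹
    rw [← h, hWE, hrkW]
  · rw [← analyticRank_smul E C⁻¹, hWE, hanW]

end Multiplicative

/-! ### The binder `h9` in the `(A, B)` currency on the multiplicative part of `T` -/

section HeightFamily

/-- **The binder `h9` in the `(A, B)` currency on the MULTIPLICATIVE part of `T`, with the (ram)
prime read on the minimal model — CONDITIONAL on `hSZ` (OPEN, labelled).** As
`bsz_h9_multiplicative_five_of_skinnerZhang` below, except that the ramified multiplicative prime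
is given in the currency of BSZ Thm 5 (c) / `Skinner2016.thmC_padicValRat_bsd_rank_zero`'s `_hram`
(byte for byte, at `p = 5`): `∃ ℓ ≠ 5` prime with `W` multiplicative at `ℓ` and `5 ∤ ord_ℓ(Δ_min)`
— so that `ℓ ∈ {2, 3}` is allowed (there `E_{A,B}` need not be minimal and `ord_ℓ(4A³ + 27B²)`
is not `ord_ℓ(Δ_min)`). Hypotheses otherwise = the printed bullets of `S₀(5)`, `S₁'(5)`, `S₁(5)`
(BSZ §3.1) in `(A, B)` currency, (irr) on `E_{A,B}`, `#Sel^(5)(E_{A,B}/ℚ) = 5`; Skinner–Zhang's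
(a)–(e) are assembled on `W` (`skinnerZhang_hypotheses_of_exists_ramified_ne`; (b)'s
`𝓛`-clause via `valuation_lInvariant_eq_valuation_padicLog_of_not_dvd`; a multiplicative
`ℓ ≡ ±1 (mod 5)` is `≥ 5` and divides `4A³ + 27B²`, so the `S₁(5)` bullet applies to it).
[cite: BhargavaSkinnerZhang2014, Thm. 9 (§2.2, p. 5), Thm. 5 (c) and Rem. 7 (§2.1, p. 5), §3.1 (p. 8), Lemma 18 (pp. 8–9)]
[claim: SkinnerZhang2014, status: under-review] -/
theorem bsz_h9_multiplicative_five_of_skinnerZhang_of_ram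
    (hSZ : ∀ (W : WeierstrassCurve ℚ) [W.IsElliptic] [W.IsGloballyMinimal] (p : ℕ) [Fact p.Prime],
      5 ≤ p → SkinnerZhang2014.Hypotheses W p → W.selmerCorank p = 1 →
      W.mordellWeilRank = 1 ∧ W.analyticRank = 1 ∧ Finite W.sha)
    (hCT : exists_casselsTate_pairing (K := ℚ)) [Fact (Nat.Prime 5)]
    {W : WeierstrassCurve ℚ} [W.IsElliptic] [W.IsGloballyMinimal] {C : VariableChange ℚ}
    {AB : ℤ × ℤ} (hfam : IsInHeightFamily AB) (hCW : C • W = shortWeierstrass AB)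
    (hA : ¬ (5 : ℤ) ∣ AB.1) (hD : (5 : ℤ) ∣ 4 * AB.1 ^ 3 + 27 * AB.2 ^ 2)
    (hfin : ¬ 5 ∣ padicValInt 5 (4 * AB.1 ^ 3 + 27 * AB.2 ^ 2))
    (hL : ∀ [(shortWeierstrass AB).IsElliptic],
      (shortWeierstrass AB).HasSplitMultiplicativeReductionAtPrime 5 →
        ∀ D : TateParameterData (shortWeierstrass AB) 5, (LInvariant D).valuation = 1)
    (hirr : (shortWeierstrass AB).HasIrreducibleModPGaloisRep 5)
    (hc : ∀ (ℓ : ℕ) [Fact ℓ.Prime], ((ℓ : ZMod 5) = 1 ∨ (ℓ : ZMod 5) = -1) →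
      0 < padicValInt ℓ (4 * AB.1 ^ 3 + 27 * AB.2 ^ 2) →
        ¬ 5 ∣ padicValInt ℓ (4 * AB.1 ^ 3 + 27 * AB.2 ^ 2))
    (hram : ∃ ℓ : ℕ, ∃ _ : Fact ℓ.Prime, ℓ ≠ 5 ∧ W.HasMultiplicativeReductionAtPrime ℓ ∧
      ¬ 5 ∣ padicValInt ℓ W.minimalDiscriminantInt)
    (hSel : Nat.card ((shortWeierstrass AB).selmerGroup 5) = 5) :
    (shortWeierstrass AB).mordellWeilRank = 1 ∧ (shortWeierstrass AB).analyticRank = 1 := by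
  haveI := isElliptic_shortWeierstrass hfam
  have hWC : C⁻¹ • shortWeierstrass AB = W := by rw [← hCW, smul_smul, inv_mul_cancel, one_smul]
  -- `ord_ℓ Δ_min(W) = ord_ℓ (4A³ + 27B²)` for every `ℓ ≥ 5`
  have hval : ∀ (ℓ : ℕ) [Fact ℓ.Prime], 5 ≤ ℓ →
      padicValInt ℓ W.minimalDiscriminantInt = padicValInt ℓ (4 * AB.1 ^ 3 + 27 * AB.2 ^ 2) :=
    fun ℓ _ hℓ ↦ padicValInt_minimalDiscriminantInt_smul_shortWeierstrass hfam W C⁻¹ hWC hℓ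
  -- (a) on `W`
  have hmultE : (shortWeierstrass AB).HasMultiplicativeReductionAtPrime 5 :=
    (hasMultiplicativeReductionAtPrime_shortWeierstrass_iff_of_isInHeightFamily 5 hfam le_rfl).2
      ⟨by exact_mod_cast hD, by exact_mod_cast hA⟩
  have hmult : W.HasMultiplicativeReductionAtPrime 5 := by
    rw [← hasMultiplicativeReductionAtPrime_smul_iff W C 5, hCW]; exact hmultE
  -- (b), first clause, on `W`
  have hfinW : ¬ 5 ∣ padicValInt 5 W.minimalDiscriminantInt := by
    rw [hval 5 le_rfl]; exact hfin
  -- (b), second clause, on `W`: transport a Tate datum of `W` to `E_{A,B}` (same `q`)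
  have hlog : W.HasSplitMultiplicativeReductionAtPrime 5 →
      ∀ D : TateParameterData W 5, (padicLog 5 D.q).valuation = 1 := by
    intro hsW D
    have hsE : (shortWeierstrass AB).HasSplitMultiplicativeReductionAtPrime 5 := by
      rw [← hCW]; exact (hasSplitMultiplicativeReductionAtPrime_smul_iff W C 5).2 hsW
    let D' : TateParameterData (shortWeierstrass AB) 5 :=
      { q := D.q
        q_ne_zero := D.q_ne_zero
        norm_q_lt_one := D.norm_q_lt_one
        tateJ_eq := by
          rw [D.tateJ_eq, ← j_eq_of_eq hCW, variableChange_j (W := W) (C := C)]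
        split := hsE }
    have h1 : (LInvariant D').valuation = 1 := hL hsE D'
    have h2 : (LInvariant D).valuation = (padicLog 5 D.q).valuation :=
      valuation_lInvariant_eq_valuation_padicLog_of_not_dvd W 5 D hfinW
    -- `LInvariant D'` and `LInvariant D` are the same number (`D'.q = D.q`)
    have h3 : LInvariant D' = LInvariant D := rfl
    rw [← h2, ← h3]; exact h1
  -- (c) on `W`
  have hirrW : W.HasIrreducibleModPGaloisRep 5 := by
    rw [← Mazur1978.hasIrreducibleModPGaloisRep_smul_iff W C 5, hCW]; exact hirr
  -- (d) on `W`: a multiplicative `ℓ ≡ ±1 (mod 5)` is `≥ 5`, divides `4A³ + 27B²`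
  have hcongr : ∀ (ℓ : ℕ) (_ : Fact ℓ.Prime), W.HasMultiplicativeReductionAtPrime ℓ →
      ((ℓ : ZMod 5) = 1 ∨ (ℓ : ZMod 5) = -1) → ¬ 5 ∣ padicValInt ℓ W.minimalDiscriminantInt := by
    intro ℓ iℓ hmℓ hℓ
    have hℓ5 : 5 ≤ ℓ := by
      have hprime := iℓ.out
      have h2 := hprime.two_le
      have hc4 : ¬ Nat.Prime 4 := by norm_num
      rcases lt_or_ge ℓ 5 with hlt | hge
      · exfalso
        -- `2, 3 ≢ ±1 (mod 5)` by evaluation in `ZMod 5`; `4` is not prime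
        interval_cases ℓ
        · exact absurd hℓ (of_decide_eq_false rfl)
        · exact absurd hℓ (of_decide_eq_false rfl)
        · exact hc4 hprime
      · exact hge
    have hmℓE : (shortWeierstrass AB).HasMultiplicativeReductionAtPrime ℓ := by
      rw [← hCW]; exact (hasMultiplicativeReductionAtPrime_smul_iff W C ℓ).2 hmℓ
    have hdvd : (ℓ : ℤ) ∣ 4 * AB.1 ^ 3 + 27 * AB.2 ^ 2 :=
      ((hasMultiplicativeReductionAtPrime_shortWeierstrass_iff_of_isInHeightFamily ℓ hfam hℓ5).1
        hmℓE).1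
    have hpos : 0 < padicValInt ℓ (4 * AB.1 ^ 3 + 27 * AB.2 ^ 2) := by
      have h := (padicValInt_dvd_iff (p := ℓ) 1 (4 * AB.1 ^ 3 + 27 * AB.2 ^ 2)).1
        (by rw [pow_one]; exact hdvd)
      rcases h with h | h
      · exact absurd h hfam.1
      · exact h
    rw [hval ℓ hℓ5]
    exact hc ℓ hℓ hpos
  have hH : SkinnerZhang2014.Hypotheses W 5 :=
    skinnerZhang_hypotheses_of_exists_ramified_ne W 5 hmult hfinW hlog hirrW hcongr hram
  exact bsz_thm9_multiplicative_of_skinnerZhang_of_smul_eq hSZ hCT hCW 5 le_rfl hH hSel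

/-- **The binder `h9` of `bsz_rankLeOne_cRank_of_pieces` in the `(A, B)` currency, on the
MULTIPLICATIVE part of `T`, below `hSZ` (OPEN, labelled) and `hCT`.** For `(A, B)` in the height
family and a global minimal model `W` of `E_{A,B}` (`C • W = E_{A,B}`), suppose, in the printed
currency of BSZ §3.1 (p. 8) and Thm 9:
* `5 ∤ A` and `5 ∣ 4A³ + 27B²` — `E_{A,B} ∈ S₀(5)` is MULTIPLICATIVE at `5` (Lemma 17; tree
  `hasMultiplicativeReductionAtPrime_shortWeierstrass_iff_of_isInHeightFamily`);
* `5 ∤ ord_5(Δ(A,B))` (`S₁'(5)`, first bullet: "`E[5]` is not finite at `5`", Remark 11) and, if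
  `E_{A,B}` is split multiplicative at `5`, `ord_5(𝓛(E_{A,B})) = 1` for the Mazur–Tate–Teitelbaum
  invariant of (any) Tate parameter datum (`S₁'(5)`, second bullet = Thm 9 (e));
* `E_{A,B}[5]` is irreducible (Thm 9 (b));
* `5 ∤ ord_ℓ(Δ(A,B))` for all primes `ℓ ≡ ±1 (mod 5)` with `ord_ℓ(Δ(A,B)) > 0` (`S₁(5)`'s bullet
  = Thm 9 (c) with Remark 7);
* there is a prime `ℓ > 5` of multiplicative reduction of `E_{A,B}` with `5 ∤ ord_ℓ(4A³ + 27B²)`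
  ("`E[5]` ramified at `ℓ`", Remark 7 — one of the two primes of Thm 9 (d) / the (ram) prime of
  Thm 5 (c); the other prime of Skinner–Zhang's (e) is `5` itself);
* `#Sel^(5)(E_{A,B}/ℚ) = 5` (Thm 9 (f)).
Then `rank E_{A,B}(ℚ) = 1 ∧ ord_{s=1} L(E_{A,B}, s) = 1`. Here `Δ(A,B)` enters only through
`ord_ℓ(4A³ + 27B²) = ord_ℓ(Δ_min)` for `ℓ ≥ 5` (tree
`padicValInt_minimalDiscriminantInt_smul_shortWeierstrass`; `Δ(E_{A,B}) = -16(4A³ + 27B²)`), and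
Skinner–Zhang's (a)–(e) are assembled on `W` (`skinnerZhang_hypotheses_of_exists_ramified_ne`,
`valuation_lInvariant_eq_valuation_padicLog_of_not_dvd` for (b)). CONDITIONAL on the unrefereed
claim `hSZ` («literal-PRE»); the good-ordinary part of `T` is the sibling
`bsz_h9_goodOrdinary_five_of_zhang_of_smul_eq` (PUB inputs).
[cite: BhargavaSkinnerZhang2014, Thm. 9 (§2.2, p. 5), §3.1 (p. 8), Lemma 18 (pp. 8–9), Rem. 7, Rem. 11 (p. 5)]
[claim: SkinnerZhang2014, status: under-review] -/
theorem bsz_h9_multiplicative_five_of_skinnerZhang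
    (hSZ : ∀ (W : WeierstrassCurve ℚ) [W.IsElliptic] [W.IsGloballyMinimal] (p : ℕ) [Fact p.Prime],
      5 ≤ p → SkinnerZhang2014.Hypotheses W p → W.selmerCorank p = 1 →
      W.mordellWeilRank = 1 ∧ W.analyticRank = 1 ∧ Finite W.sha)
    (hCT : exists_casselsTate_pairing (K := ℚ)) [Fact (Nat.Prime 5)]
    {W : WeierstrassCurve ℚ} [W.IsElliptic] [W.IsGloballyMinimal] {C : VariableChange ℚ}
    {AB : ℤ × ℤ} (hfam : IsInHeightFamily AB) (hCW : C • W = shortWeierstrass AB)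
    (hA : ¬ (5 : ℤ) ∣ AB.1) (hD : (5 : ℤ) ∣ 4 * AB.1 ^ 3 + 27 * AB.2 ^ 2)
    (hfin : ¬ 5 ∣ padicValInt 5 (4 * AB.1 ^ 3 + 27 * AB.2 ^ 2))
    (hL : ∀ [(shortWeierstrass AB).IsElliptic],
      (shortWeierstrass AB).HasSplitMultiplicativeReductionAtPrime 5 →
        ∀ D : TateParameterData (shortWeierstrass AB) 5, (LInvariant D).valuation = 1)
    (hirr : (shortWeierstrass AB).HasIrreducibleModPGaloisRep 5)
    (hc : ∀ (ℓ : ℕ) [Fact ℓ.Prime], ((ℓ : ZMod 5) = 1 ∨ (ℓ : ZMod 5) = -1) →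
      0 < padicValInt ℓ (4 * AB.1 ^ 3 + 27 * AB.2 ^ 2) →
        ¬ 5 ∣ padicValInt ℓ (4 * AB.1 ^ 3 + 27 * AB.2 ^ 2))
    (hram : ∃ ℓ : ℕ, ∃ _ : Fact ℓ.Prime, 5 < ℓ ∧
      (shortWeierstrass AB).HasMultiplicativeReductionAtPrime ℓ ∧
        ¬ 5 ∣ padicValInt ℓ (4 * AB.1 ^ 3 + 27 * AB.2 ^ 2))
    (hSel : Nat.card ((shortWeierstrass AB).selmerGroup 5) = 5) :
    (shortWeierstrass AB).mordellWeilRank = 1 ∧ (shortWeierstrass AB).analyticRank = 1 := by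
  have hWC : C⁻¹ • shortWeierstrass AB = W := by rw [← hCW, smul_smul, inv_mul_cancel, one_smul]
  -- the (ram) prime `ℓ > 5` read on the minimal model: `ord_ℓ Δ_min = ord_ℓ (4A³ + 27B²)`
  have hramW : ∃ ℓ : ℕ, ∃ _ : Fact ℓ.Prime, ℓ ≠ 5 ∧ W.HasMultiplicativeReductionAtPrime ℓ ∧
      ¬ 5 ∣ padicValInt ℓ W.minimalDiscriminantInt := by
    obtain ⟨ℓ, iℓ, hℓ, hmℓ, hrℓ⟩ := hram
    refine ⟨ℓ, iℓ, by omega, ?_, ?_⟩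
    · rw [← hasMultiplicativeReductionAtPrime_smul_iff W C ℓ, hCW]; exact hmℓ
    · rw [padicValInt_minimalDiscriminantInt_smul_shortWeierstrass hfam W C⁻¹ hWC hℓ.le]; exact hrℓ
  exact bsz_h9_multiplicative_five_of_skinnerZhang_of_ram hSZ hCT hfam hCW hA hD hfin hL hirr hc
    hramW hSel

end HeightFamily

end Literature.NumberTheory.EllipticCurves

end
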